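import Summits.FinalStateConjecture.FinalStateConjecture.Theorems.ZeroEnergyKerrOrBombStationaryLimitReductionKerrIsometryRigidityWave3Facts
import HarnessLib

/-!
# Route ZeroEnergyKerrOrBomb · crux `StationaryLimitReduction` (stmt-FinalStateConjecture-10021), line
# `symplectic-dual-of-the-bomb` — stub 1R `kerrIsometryRigidity`, wave 3: the REDUCTION of the registered
# statement to its residual obligations

Helper file (`--supports stmt-FinalStateConjecture-10021`; registered helper
`stub_kerrIsometryRigidity_of_horizonExtension`) of the lead's wave-3 stub-worker for
`stub_kerrIsometryRigidity : Sig4.stub_kerrIsometryRigidity` (lead prover-line-stmt-FinalStateConjecture-10021-a2-0,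
2026-08-16), on top of `…KerrIsometryRigidityWave3Facts` (the obligation `Prop`s `KerrEndMatching` F0,
`KerrHorizonExtension` F3, `KerrAsymptoticRigidity` F4 and the consumer `exists_futureNormalised_kerrExterior` of the
backwards isometry) and of the wave-2 reductions `isKerrChartedWith_of_chartedExtension`,
`kerrChartedClauses_of_chartedExtension`, `killingField_timelike_far_eq_smul` (p116587).

* §4 glue: the pulled-back stationary Killing field `Y = Ψ^*T` of an isometric immersion of the Kerr exterior
  is a Killing field of the Kerr metric (`isKillingField_mpullback_killing`), its norm is `g_𝓑(T, T) ∘ Ψ`, it is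
  timelike on a far region once end matching holds (`mpullback_killing_timelike_far`, clause (1) of
  `ChartIsAsymptoticallyCartesian`), `dΨ(∂_{t*}) = d⁻¹ T` when `Y = d ∂_{t*}`, and the Schwarzschild analogue of
  `killingField_timelike_far_eq_smul` from the Literature fact `StephaniEtAl2003_schwarzschildKillingFields`;
* §5 `stub_kerrIsometryRigidity_of_horizonExtension` (registered): the Killing-algebra facts
  (`ONeill1995_kerrKillingFields`, `StephaniEtAl2003_schwarzschildKillingFields`), the backwards isometry
  (`ONeill1995_kerrBackwardsIsometry`) and the three obligations F0, F3, F4 imply `Sig4.stub_kerrIsometryRigidity`.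

References: P. T. Chruściel, J. L. Costa, arXiv:0806.0016, Thm. 1.3; B. O'Neill, *The Geometry of Kerr Black
Holes* (1995), Ch. 2 p. 66, §3.1, §3.7; B. O'Neill, *Semi-Riemannian Geometry* (1983), Ch. 3 (p. 58, Prop. 3.59),
Ch. 9 (Prop. 9.25); H. Stephani et al., *Exact Solutions of Einstein's Field Equations* (2003), §15.4, §38.2.
-/

set_option linter.dupNamespace false

noncomputable section

open scoped Manifold ContDiff Topology RealInnerProductSpace
open Set Filter Function

namespace Summit.FinalStateConjecture.FinalStateConjecture.Theorems.SymplecticDualOfTheBomb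

open Summit.FinalStateConjecture.FinalStateConjecture.Theorems.OneLockedExplosion
open Literature.Geometry.Lorentzian

/-! ## §4 Glue: the pulled-back Killing field, far timelikeness in the chart, the Schwarzschild case -/

section Glue

variable [Kerr.Facts] {𝓑 : StationaryAFBlackHole.{0}} {M a : ℝ}
  {Ψ : Kerr.region a (Kerr.rPlus M a) → 𝓑.carrier}

omit [Kerr.Facts] in
/-- `(0, 0⃗) = 0` in `E4`. [folklore] -/
theorem _root_.Literature.Geometry.Lorentzian.E4.ofTimeSpace_zero_zero : E4.ofTimeSpace 0 (0 : E3) = 0 := by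
  ext i
  refine Fin.cases ?_ (fun j ↦ ?_) i
  · simp
  · rw [E4.ofTimeSpace_apply_succ]; rfl

/-- **`Ψ^*T` is a Killing field of the Kerr exterior.** For an isometric immersion `Ψ` of the smooth Kerr
exterior into `𝓑` (equidimensional, hence a local isometry), the pullback `Y = (dΨ)⁻¹ (T ∘ Ψ)` of the
stationary Killing field `T` of `𝓑` is a Killing field of `Kerr.smoothMetric M a r₊`: Killing fields pull
back under local isometries (`IsKillingField.comap_mpullback`) and the pulled-back metric `Ψ^* g_𝓑` IS the
Kerr metric (`IsIsometricImmersion`, extensionality of `PseudoRiemannianMetric` in `val`), the standing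
Levi-Civita hypotheses being proof-irrelevant (`isKillingField_congr_metric`). O'Neill 1983, Ch. 9,
Prop. 9.25 with Ch. 3, Prop. 3.59. [folklore] -/
theorem isKillingField_mpullback_killing [𝓑.metric.HasLeviCivita]
    [(Kerr.smoothMetric M a (Kerr.rPlus M a)).HasLeviCivita]
    (hΨ : PseudoRiemannianMetric.IsIsometricImmersion
      (Kerr.smoothMetric M a (Kerr.rPlus M a)).toPseudoRiemannianMetric
      𝓑.metric.toPseudoRiemannianMetric Ψ) :
    (Kerr.smoothMetric M a (Kerr.rPlus M a)).toPseudoRiemannianMetric.IsKillingField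
      (VectorField.mpullback 𝓘(ℝ, E4) (𝓡 4) Ψ 𝓑.killing) := by
  have hT : 𝓑.metric.IsKillingField 𝓑.killing := 𝓑.isStationaryKilling.isKillingField
  set gc := 𝓑.metric.toPseudoRiemannianMetric.comap (I' := 𝓘(ℝ, E4)) (N := Kerr.region a (Kerr.rPlus M a))
    PseudoRiemannianMetric.contMDiff_pullbackBilin_holds Ψ hΨ.contMDiff_add_one hΨ.injective_mfderiv
    rfl with hgc_def
  haveI hgcLC : gc.HasLeviCivita := gc.hasLeviCivita
  have hgc : (Kerr.smoothMetric M a (Kerr.rPlus M a)).toPseudoRiemannianMetric = gc :=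
    PseudoRiemannianMetric.ext (funext fun y ↦ (hΨ.2 y).symm)
  have key : gc.IsKillingField (VectorField.mpullback 𝓘(ℝ, E4) (𝓡 4) Ψ 𝓑.killing) :=
    PseudoRiemannianMetric.IsKillingField.comap_mpullback (I' := 𝓘(ℝ, E4)) (N := Kerr.region a (Kerr.rPlus M a))
      𝓑.metric.toPseudoRiemannianMetric
      PseudoRiemannianMetric.contMDiff_pullbackBilin_holds hΨ.contMDiff_add_one hΨ.injective_mfderiv
      rfl hT
  exact (PseudoRiemannianMetric.isKillingField_congr_metric hgc inferInstance hgcLC _).2 key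

/-- **The norm of `Ψ^*T` is the norm of `T`:** `g_{M,a}(Y, Y)(x) = g_𝓑(T, T)(Ψ x)` for `Y = Ψ^*T`
(`Ψ^* g_𝓑 = g_{M,a}` and `dΨ Y = T ∘ Ψ`, `mfderiv_mpullback_apply`). O'Neill 1983, Ch. 3, p. 58. [folklore] -/
theorem val_mpullback_killing
    (hΨ : PseudoRiemannianMetric.IsIsometricImmersion
      (Kerr.smoothMetric M a (Kerr.rPlus M a)).toPseudoRiemannianMetric
      𝓑.metric.toPseudoRiemannianMetric Ψ) (x : Kerr.region a (Kerr.rPlus M a)) :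
    (Kerr.smoothMetric M a (Kerr.rPlus M a)).val x
        (VectorField.mpullback 𝓘(ℝ, E4) (𝓡 4) Ψ 𝓑.killing x)
        (VectorField.mpullback 𝓘(ℝ, E4) (𝓡 4) Ψ 𝓑.killing x) =
      𝓑.metric.val (Ψ x) (𝓑.killing (Ψ x)) (𝓑.killing (Ψ x)) := by
  have h := DFunLike.congr_fun (DFunLike.congr_fun (hΨ.2 x)
    (VectorField.mpullback 𝓘(ℝ, E4) (𝓡 4) Ψ 𝓑.killing x))
    (VectorField.mpullback 𝓘(ℝ, E4) (𝓡 4) Ψ 𝓑.killing x)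
  have h' : 𝓑.metric.val (Ψ x)
      (mfderiv 𝓘(ℝ, E4) (𝓡 4) Ψ x (VectorField.mpullback 𝓘(ℝ, E4) (𝓡 4) Ψ 𝓑.killing x))
      (mfderiv 𝓘(ℝ, E4) (𝓡 4) Ψ x (VectorField.mpullback 𝓘(ℝ, E4) (𝓡 4) Ψ 𝓑.killing x)) =
      (Kerr.smoothMetric M a (Kerr.rPlus M a)).val x
        (VectorField.mpullback 𝓘(ℝ, E4) (𝓡 4) Ψ 𝓑.killing x)
        (VectorField.mpullback 𝓘(ℝ, E4) (𝓡 4) Ψ 𝓑.killing x) := h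
  rw [PseudoRiemannianMetric.mfderiv_mpullback_apply (I := 𝓡 4) (I' := 𝓘(ℝ, E4)) (M := 𝓑.carrier)
    (N := Kerr.region a (Kerr.rPlus M a)) (Φ := Ψ) hΨ.injective_mfderiv rfl] at h'
  exact h'.symm

/-- **`dΨ (∂_{t*}) = d⁻¹ T` when `Ψ^*T = d ∂_{t*}`** (`dΨ (Ψ^*T) = T`, linearity). [folklore] -/
theorem mfderiv_basisVector_of_mpullback_eq_smul
    (hΨ : PseudoRiemannianMetric.IsIsometricImmersion
      (Kerr.smoothMetric M a (Kerr.rPlus M a)).toPseudoRiemannianMetric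
      𝓑.metric.toPseudoRiemannianMetric Ψ) {d : ℝ} (hd : d ≠ 0)
    (hY : ∀ x : Kerr.region a (Kerr.rPlus M a),
      VectorField.mpullback 𝓘(ℝ, E4) (𝓡 4) Ψ 𝓑.killing x = d • Kerr.stationaryField a (Kerr.rPlus M a) x)
    (x : Kerr.region a (Kerr.rPlus M a)) :
    mfderiv 𝓘(ℝ, E4) (𝓡 4) Ψ x (E4.basisVector 0) = d⁻¹ • 𝓑.killing (Ψ x) := by
  have h := PseudoRiemannianMetric.mfderiv_mpullback_apply (I := 𝓡 4) (I' := 𝓘(ℝ, E4))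
    (M := 𝓑.carrier) (N := Kerr.region a (Kerr.rPlus M a)) (Φ := Ψ) hΨ.injective_mfderiv rfl 𝓑.killing x
  have h1 : mfderiv 𝓘(ℝ, E4) (𝓡 4) Ψ x (d • Kerr.stationaryField a (Kerr.rPlus M a) x) =
      𝓑.killing (Ψ x) := by
    rw [← hY x]; exact h
  have h2 : mfderiv 𝓘(ℝ, E4) (𝓡 4) Ψ x (d • Kerr.stationaryField a (Kerr.rPlus M a) x) =
      d • mfderiv 𝓘(ℝ, E4) (𝓡 4) Ψ x (Kerr.stationaryField a (Kerr.rPlus M a) x) :=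
    ContinuousLinearMap.map_smul _ _ _
  have h3 : mfderiv 𝓘(ℝ, E4) (𝓡 4) Ψ x (Kerr.stationaryField a (Kerr.rPlus M a) x) =
      d⁻¹ • 𝓑.killing (Ψ x) := by
    rw [← h1, h2, smul_smul, inv_mul_cancel₀ hd, one_smul]
  exact h3

omit [Kerr.Facts] in
/-- **In an asymptotically Cartesian adapted chart, `T` is timelike far out:** clause (1) of
`ChartIsAsymptoticallyCartesian` with `ε = 1/2` gives `g_𝓑(T, T)(A u) = A.bilin u (e₀, e₀) ≤ −1/2` once
`A.radius u ≥ R₀` (`A.bilin = A^* g_𝓑`, `dA e₀ = T`, `η(e₀, e₀) = −1`, `‖e₀‖ = 1`). Alexakis–Ionescu–Klainerman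
arXiv:0904.0982, §1.1. [folklore] -/
theorem exists_killing_timelike_of_chartIsAsymptoticallyCartesian (A : 𝓑.AdaptedChart)
    (hA : ChartIsAsymptoticallyCartesian A) :
    ∃ R₀ : ℝ, ∀ u : A.domain, R₀ ≤ A.radius u.1 →
      𝓑.metric.val (A.toFun u) (𝓑.killing (A.toFun u)) (𝓑.killing (A.toFun u)) ≤ -(1 / 2) := by
  obtain ⟨R₀, hR₀⟩ := hA.1 (1 / 2) one_half_pos
  refine ⟨R₀, fun u hu ↦ ?_⟩
  have h1 : A.bilin u.1 (E4.basisVector 0) (E4.basisVector 0) =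
      𝓑.metric.val (A.toFun u) (𝓑.killing (A.toFun u)) (𝓑.killing (A.toFun u)) := by
    rw [A.bilin_eq u]
    change 𝓑.metric.val (A.toFun u) (mfderiv 𝓘(ℝ, E4) (𝓡 4) A.toFun u (E4.basisVector 0))
      (mfderiv 𝓘(ℝ, E4) (𝓡 4) A.toFun u (E4.basisVector 0)) = _
    rw [A.mfderiv_toFun_basisVector u]
  have h2 : |A.bilin u.1 (E4.basisVector 0) (E4.basisVector 0) -
      Minkowski.bilin (E4.basisVector 0) (E4.basisVector 0)| ≤ 1 / 2 := by
    have h : ‖A.bilin u.1 (E4.basisVector 0) (E4.basisVector 0) -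
        Minkowski.bilin (E4.basisVector 0) (E4.basisVector 0)‖ ≤
        ‖A.bilin u.1 - Minkowski.bilin‖ * ‖(E4.basisVector 0 : E4)‖ * ‖(E4.basisVector 0 : E4)‖ :=
      (A.bilin u.1 - Minkowski.bilin).le_opNorm₂ (E4.basisVector 0) (E4.basisVector 0)
    have h1' : ‖(E4.basisVector 0 : E4)‖ = 1 := by rw [E4.basisVector, PiLp.norm_single, norm_one]
    rw [Real.norm_eq_abs, h1', mul_one, mul_one] at h
    exact h.trans (hR₀ u hu)
  rw [Minkowski.bilin_basisVector_zero] at h2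
  rw [← h1]
  linarith [(abs_le.1 h2).2]

/-- **`Ψ^*T` is timelike on a far region of the Kerr exterior, given end matching:** if the `A`-radius of the
chart preimage of `Ψ x` is `≥ R₀` (the radius beyond which `T` is timelike in the chart) whenever
`r(x) ≥ R`, then `g_{M,a}(Y, Y)(x) = g_𝓑(T, T)(Ψ x) < 0` there. [folklore] -/
theorem mpullback_killing_timelike_far (A : 𝓑.AdaptedChart) (hA : ChartIsAsymptoticallyCartesian A)
    (hΨr : Set.range Ψ = 𝓑.doc)
    (hΨ : PseudoRiemannianMetric.IsIsometricImmersion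
      (Kerr.smoothMetric M a (Kerr.rPlus M a)).toPseudoRiemannianMetric
      𝓑.metric.toPseudoRiemannianMetric Ψ)
    (hfar : ∀ R₁ : ℝ, ∃ R : ℝ, ∀ x : Kerr.region a (Kerr.rPlus M a), R ≤ Kerr.radius a x.1 →
      R₁ ≤ A.radius (chartPreimage A (Ψ x))) :
    ∃ R : ℝ, ∀ x : Kerr.region a (Kerr.rPlus M a), R ≤ Kerr.radius a x.1 →
      (Kerr.smoothMetric M a (Kerr.rPlus M a)).val x
        (VectorField.mpullback 𝓘(ℝ, E4) (𝓡 4) Ψ 𝓑.killing x)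
        (VectorField.mpullback 𝓘(ℝ, E4) (𝓡 4) Ψ 𝓑.killing x) < 0 := by
  obtain ⟨R₀, hR₀⟩ := exists_killing_timelike_of_chartIsAsymptoticallyCartesian A hA
  obtain ⟨R, hR⟩ := hfar R₀
  refine ⟨R, fun x hx ↦ ?_⟩
  have hxr : Ψ x ∈ Set.range A.toFun := A.doc_subset_range (hΨr ▸ Set.mem_range_self x)
  obtain ⟨hu, hAu⟩ := chartPreimage_spec A hxr
  have keyG : ∀ p q : 𝓑.carrier, p = q →
      𝓑.metric.val p (𝓑.killing p) (𝓑.killing p) = 𝓑.metric.val q (𝓑.killing q) (𝓑.killing q) := by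
    rintro p q rfl; rfl
  rw [val_mpullback_killing hΨ x, ← keyG _ _ hAu]
  linarith [hR₀ ⟨chartPreimage A (Ψ x), hu⟩ (hR x hx)]

omit [Kerr.Facts] in
/-- `η(α e₀ + (0, z), α e₀ + (0, z)) = −α² + ‖z‖²`. O'Neill 1983, Ch. 3, p. 55. [folklore] -/
theorem minkowski_bilin_smul_basisVector_add_ofTimeSpace (α : ℝ) (z : E3) :
    Minkowski.bilin (α • E4.basisVector 0 + E4.ofTimeSpace 0 z) (α • E4.basisVector 0 + E4.ofTimeSpace 0 z) =
      -α ^ 2 + ‖z‖ ^ 2 := by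
  rw [Minkowski.bilin_apply, EuclideanSpace.real_norm_sq_eq]
  simp [Fin.succ_ne_zero, sq]

/-- **Schwarzschild analogue of `killingField_timelike_far_eq_smul`** (the `a = 0` case of input F1): GIVEN
`StephaniEtAl2003_schwarzschildKillingFields`, a Killing field of the Schwarzschild exterior (`M > 0`) which
is timelike at every point of a far region `{r ≥ R}` is a non-zero constant multiple of `∂_{t*}`: by the
fact it is `α ∂_{t*} + (0, W₀ y)` with `W₀ ∈ so(3)`; if `W₀ v ≠ 0` then at the far slice points `(0, t v)`,
`g ≥ η = −α² + t² ‖W₀ v‖² > 0` for large `t` (`g = η + 2H ℓ ⊗ ℓ`, `H ≥ 0`), so `W₀ = 0`; and `α ≠ 0` because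
the field is timelike, hence non-zero, at a far point. Stephani et al. 2003, §15.4; O'Neill 1995, Ch. 2,
p. 66 (2). [folklore] -/
theorem schwarzschild_killingField_timelike_far_eq_smul {M : ℝ}
    [(Kerr.smoothMetric M 0 (Kerr.rPlus M 0)).HasLeviCivita]
    (hF : StephaniEtAl2003_schwarzschildKillingFields) (hM : 0 < M)
    (X : Π x : Kerr.exterior M 0, TangentSpace 𝓘(ℝ, E4) x) (R : ℝ)
    (hX : (Kerr.smoothMetric M 0 (Kerr.rPlus M 0)).toPseudoRiemannianMetric.IsKillingField X)
    (htl : ∀ x : Kerr.exterior M 0, R ≤ Kerr.radius 0 x.1 →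
      (Kerr.smoothMetric M 0 (Kerr.rPlus M 0)).val x (X x) (X x) < 0) :
    ∃ d : ℝ, d ≠ 0 ∧ ∀ x : Kerr.exterior M 0, X x = d • Kerr.stationaryField 0 (Kerr.rPlus M 0) x := by
  obtain ⟨α, W₀, -, hXW⟩ := hF M hM X hX
  -- far slice points `(0, t v)` of the exterior
  have hpt : ∀ (v : E3) (t : ℝ), 0 < t → v ≠ 0 → max (Kerr.rPlus M 0) 0 + |R| < t * ‖v‖ →
      ∃ x : Kerr.exterior M 0, x.1 = E4.ofTimeSpace 0 (t • v) ∧ R ≤ Kerr.radius 0 x.1 := by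
    intro v t ht hv hlt
    have hr : Kerr.radius 0 (E4.ofTimeSpace 0 (t • v)) = t * ‖v‖ := by
      rw [Kerr.radius_zero_left, E4.spatialNorm_ofTimeSpace, norm_smul, Real.norm_of_nonneg ht.le]
    have hmem : E4.ofTimeSpace 0 (t • v) ∈ Kerr.exterior M 0 := by
      rw [Kerr.mem_exterior, hr]; linarith [abs_nonneg R]
    exact ⟨⟨_, hmem⟩, rfl, by rw [hr]; linarith [le_abs_self R, le_max_right (Kerr.rPlus M 0) 0]⟩
  -- the value of `g(X, X)` at such a point is at least `−α² + t² ‖W₀ v‖²`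
  have hval : ∀ x : Kerr.exterior M 0, ∀ (v : E3) (t : ℝ), x.1 = E4.ofTimeSpace 0 (t • v) →
      -α ^ 2 + (t * ‖W₀ v‖) ^ 2 ≤ (Kerr.smoothMetric M 0 (Kerr.rPlus M 0)).val x (X x) (X x) := by
    intro x v t hx
    have hXx : (X x : E4) = α • E4.basisVector 0 + E4.ofTimeSpace 0 (W₀ (t • v)) := by
      rw [hXW x, hx, E4.spatial_ofTimeSpace]
    rw [Kerr.smoothMetric_val]
    change -α ^ 2 + (t * ‖W₀ v‖) ^ 2 ≤ Kerr.bilin M 0 x.1 (X x : E4) (X x : E4)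
    rw [hXx, Kerr.bilin_apply, minkowski_bilin_smul_basisVector_add_ofTimeSpace, map_smul, norm_smul,
      Real.norm_eq_abs]
    have hH : 0 ≤ Kerr.scalarH M 0 x.1 := Kerr.scalarH_nonneg hM.le 0 _
    have habs : (|t| * ‖W₀ v‖) ^ 2 = (t * ‖W₀ v‖) ^ 2 := by rw [mul_pow, mul_pow, sq_abs]
    rw [habs]
    nlinarith [mul_nonneg (mul_nonneg zero_le_two hH)
      (mul_self_nonneg (Kerr.nullCovector 0 x.1 (α • E4.basisVector 0 + E4.ofTimeSpace 0 (t • W₀ v))))]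
  -- `W₀ = 0`
  have hW : ∀ v : E3, W₀ v = 0 := by
    intro v
    by_contra hv
    have hv0 : v ≠ 0 := fun h ↦ hv (by rw [h, map_zero])
    have hnv : 0 < ‖v‖ := norm_pos_iff.2 hv0
    have hnW : 0 < ‖W₀ v‖ := norm_pos_iff.2 hv
    set t : ℝ := (max (Kerr.rPlus M 0) 0 + |R| + 1) / ‖v‖ + (|α| + 1) / ‖W₀ v‖ with ht_def
    have ht1 : (max (Kerr.rPlus M 0) 0 + |R| + 1) / ‖v‖ ≤ t := by
      rw [ht_def]; linarith [div_nonneg (by positivity : 0 ≤ |α| + 1) hnW.le]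
    have ht2 : (|α| + 1) / ‖W₀ v‖ ≤ t := by
      rw [ht_def]
      linarith [div_nonneg (by positivity : 0 ≤ max (Kerr.rPlus M 0) 0 + |R| + 1) hnv.le]
    have ht : 0 < t := lt_of_lt_of_le (by positivity) ht2
    have hlt : max (Kerr.rPlus M 0) 0 + |R| < t * ‖v‖ := by
      have := (div_le_iff₀ hnv).1 ht1; linarith
    obtain ⟨x, hx, hxR⟩ := hpt v t ht hv0 hlt
    have h1 := hval x v t hx
    have h2 := htl x hxR
    have h3 : |α| + 1 ≤ t * ‖W₀ v‖ := (div_le_iff₀ hnW).1 ht2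
    nlinarith [abs_nonneg α, sq_abs α]
  -- hence `X = α ∂_{t*}` with `α ≠ 0`
  have hXα : ∀ x : Kerr.exterior M 0, X x = α • Kerr.stationaryField 0 (Kerr.rPlus M 0) x := by
    intro x
    have h := hXW x
    rw [hW, E4.ofTimeSpace_zero_zero, add_zero] at h
    exact h
  have hα : α ≠ 0 := by
    intro hα0
    set v : E3 := EuclideanSpace.single 0 1 with hv_def
    have hv : v ≠ 0 := by
      rw [hv_def]; intro h
      have := congrArg (fun w : E3 ↦ w 0) h
      simp at this
    have hnv : 0 < ‖v‖ := norm_pos_iff.2 hv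
    set t : ℝ := (max (Kerr.rPlus M 0) 0 + |R| + 1) / ‖v‖ with ht_def
    have ht : 0 < t := by rw [ht_def]; positivity
    have hlt : max (Kerr.rPlus M 0) 0 + |R| < t * ‖v‖ := by
      rw [ht_def, div_mul_cancel₀ _ hnv.ne']; linarith
    obtain ⟨x, hx, hxR⟩ := hpt v t ht hv hlt
    have h2 := htl x hxR
    rw [hXα x, hα0, zero_smul, map_zero] at h2
    simp at h2
  exact ⟨α, hα, hXα⟩

end Glue

/-! ## §5 The assembly: `Sig4.stub_kerrIsometryRigidity` from the named facts and the three obligations -/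

/-- **Registered helper `stub_kerrIsometryRigidity_of_horizonExtension`** — stub 1R REDUCED to its residual
obligations: GIVEN the Killing algebra of Kerr (`ONeill1995_kerrKillingFields`, `a ≠ 0`) and of Schwarzschild
(`StephaniEtAl2003_schwarzschildKillingFields`, `a = 0`), the backwards isometry (`ONeill1995_kerrBackwardsIsometry`),
and the three obligations `KerrEndMatching` (F0), `KerrHorizonExtension` (F3), `KerrAsymptoticRigidity` (F4),
the registered statement `Sig4.stub_kerrIsometryRigidity` holds. Proof: `IsKerrExterior` gives `(M, a, Ψ)`;
`Y = Ψ^*T` is a Killing field of the Kerr exterior (`isKillingField_mpullback_killing`), timelike on a far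
region by end matching and clause (1) of `ChartIsAsymptoticallyCartesian` (`mpullback_killing_timelike_far`),
hence `Y = d ∂_{t*}`, `d ≠ 0` (`killingField_timelike_far_eq_smul`, p116587, resp. its Schwarzschild
analogue), i.e. `dΨ (∂_{t*}) = d⁻¹ T`; WLOG `d > 0` (`exists_futureNormalised_kerrExterior`); F3 extends the
normalised `Ψ` to `Φ` on `{r > r₀}`; `Θ := chartPreimage A ∘ Φ` has the six chart clauses
(`kerrChartedClauses_of_chartedExtension`, p116587) and sends infinity to infinity (end matching again),
so F4 gives its asymptotic clause and `isKerrChartedWith_of_chartedExtension` (p116587) concludes.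
Chruściel–Costa arXiv:0806.0016, Thm. 1.3; O'Neill 1995, §3.1, §3.7. [folklore] -/
theorem stub_kerrIsometryRigidity_of_horizonExtension : ONeill1995_kerrKillingFields → StephaniEtAl2003_schwarzschildKillingFields → ONeill1995_kerrBackwardsIsometry → KerrEndMatching → KerrHorizonExtension → KerrAsymptoticRigidity → Sig4.stub_kerrIsometryRigidity := by
  intro hF1 hF1' hF2 hF0 hF3 hF4 𝓑 A htel hreg hhor hcart hschw hKerr
  haveI hKF : Kerr.Facts := kerrFacts
  haveI : 𝓑.metric.HasLeviCivita := 𝓑.metric.toPseudoRiemannianMetric.hasLeviCivita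
  obtain ⟨M, a, hMa, Ψ, hΨi, hΨr, hΨiso⟩ := hKerr
  haveI hKLC : (Kerr.smoothMetric M a (Kerr.rPlus M a)).HasLeviCivita :=
    (Kerr.smoothMetric M a (Kerr.rPlus M a)).toPseudoRiemannianMetric.hasLeviCivita
  -- Step 1–2: the pulled-back Killing field and its far timelikeness (end matching for `Ψ`)
  set Y := VectorField.mpullback 𝓘(ℝ, E4) (𝓡 4) Ψ 𝓑.killing with hY_def
  have hYK := isKillingField_mpullback_killing (𝓑 := 𝓑) (M := M) (a := a) (Ψ := Ψ) hΨiso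
  have hfarΨ := hF0 𝓑 A M a Ψ htel hreg hhor hcart hschw hMa hΨi hΨr hΨiso
  obtain ⟨R, hR⟩ := mpullback_killing_timelike_far A hcart hΨr hΨiso hfarΨ
  -- Step 3: the Killing algebra: `Y = d ∂_{t*}`, `d ≠ 0`
  have hYd : ∃ d : ℝ, d ≠ 0 ∧ ∀ x : Kerr.exterior M a, Y x = d • Kerr.stationaryField a (Kerr.rPlus M a) x := by
    by_cases ha : a = 0
    · subst ha
      exact schwarzschild_killingField_timelike_far_eq_smul hF1' hMa.pos Y R hYK hR
    · exact killingField_timelike_far_eq_smul M a hF1 ha hMa Y R hYK hR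
  obtain ⟨d, hd, hYd⟩ := hYd
  -- Step 4–5: `dΨ e₀ = d⁻¹ T`; WLOG future-normalised
  have hΨT : ∀ x : Kerr.exterior M a,
      mfderiv 𝓘(ℝ, E4) (𝓡 4) Ψ x (E4.basisVector 0) = d⁻¹ • 𝓑.killing (Ψ x) :=
    mfderiv_basisVector_of_mpullback_eq_smul hΨiso hd hYd
  obtain ⟨c, Ψ', hc, hΨ'i, hΨ'r, hΨ'iso, hΨ'T⟩ :=
    exists_futureNormalised_kerrExterior 𝓑 M a d⁻¹ Ψ hF2 hMa hΨi hΨr hΨiso (inv_ne_zero hd) hΨT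
  -- Step 6: the horizon extension
  obtain ⟨r₀, Φ, hr₀, hr₀', hΦs, hΦi, hΦr, hΦT, hΦΨ⟩ :=
    hF3 𝓑 A M a c Ψ' htel hreg hhor hcart hMa hc hΨ'i hΨ'r hΨ'iso hΨ'T
  -- Step 7: end matching for `Ψ'`, read on `Φ`
  have hfar : ∀ R₁ : ℝ, ∃ R : ℝ, ∀ x ∈ (Kerr.exterior M a : Set E4), R ≤ Kerr.radius a x →
      R₁ ≤ A.radius (chartPreimage A (Φ x)) := by
    intro R₁
    obtain ⟨R', hR'⟩ := hF0 𝓑 A M a Ψ' htel hreg hhor hcart hschw hMa hΨ'i hΨ'r hΨ'iso R₁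
    exact ⟨R', fun x hx hxR ↦ by rw [hΦΨ ⟨x, hx⟩]; exact hR' ⟨x, hx⟩ hxR⟩
  -- Step 8: the chart-level hypotheses of p116587 for `Φ`
  have hA : ∀ x : A.domain, Function.Injective (mfderiv 𝓘(ℝ, E4) (𝓡 4) A.toFun x) := hcart.2.2.1
  have hext : (Kerr.exterior M a : Set E4) ⊆ (Kerr.region a r₀ : Set E4) := Kerr.region_mono a hr₀'.le
  have hΦmf : ∀ x : Kerr.exterior M a, ∀ v : E4,
      mfderiv 𝓘(ℝ, E4) (𝓡 4) Ψ' x v = mfderiv 𝓘(ℝ, E4) (𝓡 4) Φ x.1 v := by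
    intro x v
    have hΦd : MDifferentiableAt 𝓘(ℝ, E4) (𝓡 4) Φ x.1 :=
      (hΦs.contMDiffAt ((Kerr.region a r₀).isOpen.mem_nhds (hext x.2))).mdifferentiableAt (by simp)
    have hcomp : Ψ' = Φ ∘ (Subtype.val : Kerr.exterior M a → E4) := funext fun y ↦ (hΦΨ y).symm
    have h := mfderiv_comp x hΦd
      (Literature.Geometry.Manifold.OpenSubmanifold.mdifferentiableAt_subtype_val (I := 𝓘(ℝ, E4)) x)
    rw [Literature.Geometry.Manifold.OpenSubmanifold.mfderiv_subtype_val, ← hcomp] at h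
    rw [h]
    rfl
  have keyG : ∀ p q : 𝓑.carrier, p = q → ∀ v w : E4, 𝓑.metric.val p v w = 𝓑.metric.val q v w := by
    rintro p q rfl v w; rfl
  have hΦiso : ∀ x ∈ (Kerr.exterior M a : Set E4), ∀ v w : E4,
      𝓑.metric.val (Φ x) (mfderiv 𝓘(ℝ, E4) (𝓡 4) Φ x v) (mfderiv 𝓘(ℝ, E4) (𝓡 4) Φ x w) =
        Kerr.bilin M a x v w := by
    intro x hx v w
    have h := DFunLike.congr_fun (DFunLike.congr_fun (hΨ'iso.2 ⟨x, hx⟩) v) w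
    have h' : 𝓑.metric.val (Ψ' ⟨x, hx⟩) (mfderiv 𝓘(ℝ, E4) (𝓡 4) Ψ' ⟨x, hx⟩ v)
        (mfderiv 𝓘(ℝ, E4) (𝓡 4) Ψ' ⟨x, hx⟩ w) = Kerr.bilin M a x v w := h
    rw [hΦmf ⟨x, hx⟩ v, hΦmf ⟨x, hx⟩ w] at h'
    rw [keyG _ _ (hΦΨ ⟨x, hx⟩)]
    exact h'
  have hΦdoc : Φ '' (Kerr.exterior M a : Set E4) = 𝓑.doc := by
    rw [Set.image_eq_range, ← hΨ'r]
    exact congrArg Set.range (funext fun y ↦ hΦΨ y)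
  obtain ⟨h5, h6, h7, h8, h9, h10⟩ :=
    kerrChartedClauses_of_chartedExtension 𝓑 A M a c r₀ Φ hr₀'.le hA hΦs hΦi hΦr hΦT hΦiso hΦdoc
  -- Step 9: asymptotic rigidity for `Θ := chartPreimage A ∘ Φ`
  have hL := hF4 𝓑 A M a c (fun x ↦ chartPreimage A (Φ x)) hcart hschw hMa hc (h5.mono hext)
    (h6.mono hext) (h7.mono_left hext) (fun x hx s ↦ h8 x (hext hx) s) h9 h10 hfar
  -- Step 10: assemble
  exact ⟨M, a, c, r₀, fun x ↦ chartPreimage A (Φ x),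
    isKerrChartedWith_of_chartedExtension 𝓑 A M a c r₀ Φ hMa hc hr₀ hr₀' hA hΦs hΦi hΦr hΦT hΦiso
      hΦdoc hL⟩

end Summit.FinalStateConjecture.FinalStateConjecture.Theorems.SymplecticDualOfTheBomb

end
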